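import Summits.ABC.StewartYu.GenThreeVanishingPoints
import Mathlib.Data.Nat.Choose.Sum
import HarnessLib

/-!
# Gen-3 engines ⇒ the zero estimate, IV: the Laurent shift (Nesterenko 2003, (5.3)) — from the
# engine's identities with INTEGER exponent vectors to an honest polynomial of multidegree `(D₀, 2D)`

`Summits/ABC/StewartYu/GenThreeVanishingShift.lean` — cell `abc-stewartyu` (rung F-A1 = Stewart–Yu 2001,
route `PadicPrimesKummerThird`, cruxes `Y07Odd` stmt-ABC-19658 / `Y07Two` stmt-ABC-19659), seat p3 (g4).
Theorems only; companion of `GenThreeVanishing{,Points}.lean` (deliverables V3/V4/V5 of the V/E interface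
sheet `plan/m3/ZE-INTERFACE.md`).

The engine's auxiliary function after the last extrapolation step is a Laurent polynomial
`P = ∑ᵢ qᵢ Y₀^{aᵢ} Y^{κᵢ}` with INTEGER exponent vectors `κᵢ ∈ ℤᵐ`, `|κᵢⱼ| ≤ Dⱼ`, `aᵢ ≤ D₀`
(Nesterenko 2003, (5.3)/(5.5): `κ = N(𝐥 − 𝐯_S)`), and its identities read
`∑ᵢ qᵢ · aᵢ!/(aᵢ−t)! · (xc)^{aᵢ−t} · ∏ₖ (b_{j₀}κᵢₖ − bₖκᵢⱼ₀)^{νₖ} · ∏ⱼ ξⱼ^{x·κᵢⱼ} = 0` ((5.4) unfolded,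
integer powers).  The zero estimate wants an honest polynomial `Q` with `deg_{Y₀} Q ≤ D₀`,
`deg_{Yⱼ} Q ≤ 2Dⱼ`: `Q = Y^D · P`, exponents `sᵢ = (aᵢ; κᵢ + D)`.  This file proves:

* `prod_add_pow_eq_sum` — the multi-binomial expansion `∏ₖ (uₖ + wₖ)^{μₖ} = ∑_{ν ≤ μ} ∏ₖ C(μₖ,νₖ) uₖ^{νₖ} wₖ^{μₖ−νₖ}`;
* `presentedIdentities_of_laurentIdentities` — the SHIFT LEMMA: the shift changes the scalars
  `b_{j₀}sₖ₊₁ − bₖs_{j₀+1}` by the constant `b_{j₀}Dₖ − bₖD_{j₀}` and the torus value by the common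
  factor `∏ⱼ ξⱼ^{x Dⱼ}`, so the identity family of the shifted presentation (the hypothesis `hId` of
  `vanishesToOrder_sumset_of_presentedIdentities`) is a combination of the Laurent identities with
  `ν ≤ μ` — which are all available because the range `t + ∑ νₖ ≤ T`, `ν_{j₀} = 0` is downward closed;
* `degreeOf_sum_monomial_le` (V4/V5) and `sum_monomial_ne_zero` (V3: `Q ≠ 0` from ONE nonzero
  coefficient of an injective presentation);
* HEADLINE `exists_obstruction_of_laurentIdentities`: Laurent data + identities + `hZ : Nesterenko2003_prop51`
  ⇒ the obstruction subgroup with Nesterenko's inequality at multidegree `(D₀, D)`.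

References: Yu. V. Nesterenko, *Linear forms in logarithms of rational numbers*, LNM 1819 (2003), §5,
(5.3)–(5.5) (p. 90), Prop. 5.1 and p. 92.
-/

noncomputable section

open MvPolynomial Finset
open Literature.NumberTheory.Transcendental
open Literature.NumberTheory.Transcendental.GaGm

namespace Summit.ABC.StewartYu.GenThreeVanishing

section Shift

variable {m : ℕ}

/-- **Multi-binomial expansion**: `∏ₖ (uₖ + wₖ)^{μₖ} = ∑_{ν, νₖ ≤ μₖ} ∏ₖ C(μₖ, νₖ) · uₖ^{νₖ} · wₖ^{μₖ − νₖ}`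
(the sum over `ν ∈ ∏ₖ {0, …, μₖ}` as a `Fintype.piFinset`). [folklore] -/
theorem prod_add_pow_eq_sum (u w : Fin m → ℂ) (μ : Fin m → ℕ) :
    ∏ k, (u k + w k) ^ μ k =
      ∑ ν ∈ Fintype.piFinset fun k => Finset.range (μ k + 1),
        ∏ k, (((μ k).choose (ν k) : ℕ) : ℂ) * u k ^ ν k * w k ^ (μ k - ν k) := by
  calc ∏ k, (u k + w k) ^ μ k
      = ∏ k, ∑ n ∈ Finset.range (μ k + 1), u k ^ n * w k ^ (μ k - n) * (((μ k).choose n : ℕ) : ℂ) :=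
        Finset.prod_congr rfl fun k _ => add_pow (u k) (w k) (μ k)
    _ = ∑ ν ∈ Fintype.piFinset fun k => Finset.range (μ k + 1),
          ∏ k, (u k ^ ν k * w k ^ (μ k - ν k) * (((μ k).choose (ν k) : ℕ) : ℂ)) :=
        Finset.prod_univ_sum _ _
    _ = _ := Finset.sum_congr rfl fun ν _ => Finset.prod_congr rfl fun k _ => by ring

/-- Membership in the box `∏ₖ {0, …, μₖ}` means `νₖ ≤ μₖ`. [folklore] -/
theorem le_of_mem_piFinset_range {μ ν : Fin m → ℕ}
    (hν : ν ∈ Fintype.piFinset fun k => Finset.range (μ k + 1)) (k : Fin m) : ν k ≤ μ k := by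
  have := Fintype.mem_piFinset.mp hν k
  rw [Finset.mem_range] at this
  omega

/-- **THE SHIFT LEMMA** (Nesterenko 2003, (5.3) ⇒ (5.4)).  Laurent data: exponents `aᵢ ∈ ℕ`,
`κᵢ ∈ ℤᵐ`, coefficients `qᵢ`; shifted exponents `sᵢ` with `sᵢ(0) = aᵢ`, `sᵢ(j+1) = κᵢⱼ + Dⱼ`.  If the
LAURENT identities hold for all `|x| ≤ B` and all `(t, ν)` with `ν_{j₀} = 0`, `t + ∑ νₖ ≤ T`, then the
identities of the shifted presentation (hypothesis `hId` of
`vanishesToOrder_sumset_of_presentedIdentities`) hold in the same range. [cite: Nesterenko2003, §5 (5.3)–(5.4)] -/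
theorem presentedIdentities_of_laurentIdentities (b : Fin m → ℂ) (j₀ : Fin m) (c : ℂ) (ξ : Fin m → ℂˣ)
    {ι : Type*} (I : Finset ι) (a : ι → ℕ) (κ : ι → Fin m → ℤ) (q : ι → ℂ) (D : Fin m → ℕ)
    (s : ι → (Fin (m + 1) →₀ ℕ)) (hs0 : ∀ i ∈ I, s i 0 = a i)
    (hsj : ∀ i ∈ I, ∀ j : Fin m, (((s i) j.succ : ℕ) : ℤ) = κ i j + D j)
    (B : ℤ) (T : ℕ)
    (hL : ∀ x : ℤ, |x| ≤ B → ∀ (t : ℕ) (ν : Fin m → ℕ), ν j₀ = 0 → t + ∑ k, ν k ≤ T →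
      ∑ i ∈ I, q i * (((a i).descFactorial t : ℕ) : ℂ) * ((x : ℂ) * c) ^ (a i - t) *
        (∏ k, (b j₀ * (κ i k : ℂ) - b k * (κ i j₀ : ℂ)) ^ ν k) *
        ∏ j, (ξ j : ℂ) ^ (x * κ i j) = 0) :
    ∀ x : ℤ, |x| ≤ B → ∀ (t : ℕ) (μ : Fin m → ℕ), μ j₀ = 0 → t + ∑ k, μ k ≤ T →
      ∑ i ∈ I, q i * ((((s i) 0).descFactorial t : ℕ) : ℂ) * ((x : ℂ) * c) ^ ((s i) 0 - t) *
        (∏ k, (b j₀ * (((s i) k.succ : ℕ) : ℂ) - b k * (((s i) j₀.succ : ℕ) : ℂ)) ^ μ k) *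
        ∏ j, ((ξ j : ℂ) ^ x) ^ ((s i) j.succ) = 0 := by
  classical
  intro x hx t μ hμ hsum
  -- the constant shift of the scalars and the common torus factor
  set Ls : Fin m → ℂ := fun k => b j₀ * (D k : ℂ) - b k * (D j₀ : ℂ) with hLs
  set F : ℂ := ∏ j, (ξ j : ℂ) ^ (x * (D j : ℤ)) with hF
  have hcast : ∀ i ∈ I, ∀ j : Fin m, (((s i) j.succ : ℕ) : ℂ) = (κ i j : ℂ) + (D j : ℂ) := by
    intro i hi j
    have h := congrArg (fun z : ℤ => (z : ℂ)) (hsj i hi j)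
    simpa using h
  -- rewrite each summand
  have hterm : ∀ i ∈ I,
      q i * ((((s i) 0).descFactorial t : ℕ) : ℂ) * ((x : ℂ) * c) ^ ((s i) 0 - t) *
        (∏ k, (b j₀ * (((s i) k.succ : ℕ) : ℂ) - b k * (((s i) j₀.succ : ℕ) : ℂ)) ^ μ k) *
        ∏ j, ((ξ j : ℂ) ^ x) ^ ((s i) j.succ) =
      F * ∑ ν ∈ Fintype.piFinset fun k => Finset.range (μ k + 1),
        (∏ k, (((μ k).choose (ν k) : ℕ) : ℂ) * Ls k ^ (μ k - ν k)) *
        (q i * (((a i).descFactorial t : ℕ) : ℂ) * ((x : ℂ) * c) ^ (a i - t) *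
          (∏ k, (b j₀ * (κ i k : ℂ) - b k * (κ i j₀ : ℂ)) ^ ν k) *
          ∏ j, (ξ j : ℂ) ^ (x * κ i j)) := by
    intro i hi
    rw [hs0 i hi]
    -- scalars
    have hsc : (∏ k, (b j₀ * (((s i) k.succ : ℕ) : ℂ) - b k * (((s i) j₀.succ : ℕ) : ℂ)) ^ μ k) =
        ∏ k, ((b j₀ * (κ i k : ℂ) - b k * (κ i j₀ : ℂ)) + Ls k) ^ μ k := by
      refine Finset.prod_congr rfl fun k _ => ?_
      rw [hcast i hi k, hcast i hi j₀, hLs]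
      ring
    -- torus values
    have htor : ∏ j, ((ξ j : ℂ) ^ x) ^ ((s i) j.succ) = (∏ j, (ξ j : ℂ) ^ (x * κ i j)) * F := by
      rw [hF, ← Finset.prod_mul_distrib]
      refine Finset.prod_congr rfl fun j _ => ?_
      have hξ : (ξ j : ℂ) ≠ 0 := (ξ j).ne_zero
      rw [← zpow_natCast, ← zpow_mul, hsj i hi j, mul_add, zpow_add₀ hξ]
    rw [hsc, prod_add_pow_eq_sum, htor]
    simp only [Finset.mul_sum, Finset.sum_mul]
    refine Finset.sum_congr rfl fun ν _ => ?_
    simp only [Finset.prod_mul_distrib]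
    ring
  rw [Finset.sum_congr rfl hterm, ← Finset.mul_sum, Finset.sum_comm]
  -- every inner sum is a Laurent identity with `ν ≤ μ`
  have hinner : ∀ ν ∈ Fintype.piFinset (fun k => Finset.range (μ k + 1)),
      ∑ i ∈ I, (∏ k, (((μ k).choose (ν k) : ℕ) : ℂ) * Ls k ^ (μ k - ν k)) *
        (q i * (((a i).descFactorial t : ℕ) : ℂ) * ((x : ℂ) * c) ^ (a i - t) *
          (∏ k, (b j₀ * (κ i k : ℂ) - b k * (κ i j₀ : ℂ)) ^ ν k) *
          ∏ j, (ξ j : ℂ) ^ (x * κ i j)) = 0 := by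
    intro ν hν
    have hle := le_of_mem_piFinset_range hν
    rw [← Finset.mul_sum, hL x hx t ν (by have := hle j₀; omega)
      (le_trans (Nat.add_le_add_left (Finset.sum_le_sum fun k _ => hle k) t) hsum), mul_zero]
  rw [Finset.sum_eq_zero hinner, mul_zero]

/-- Degree bookkeeping of a presentation (V4/V5): `deg_{Y_l} (∑ᵢ qᵢ Y^{sᵢ}) ≤ N` as soon as
`sᵢ(l) ≤ N` for all `i`. [folklore] -/
theorem degreeOf_sum_monomial_le {ι : Type*} (I : Finset ι) (s : ι → (Fin (m + 1) →₀ ℕ)) (q : ι → ℂ)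
    (l : Fin (m + 1)) (N : ℕ) (h : ∀ i ∈ I, s i l ≤ N) :
    (∑ i ∈ I, monomial (s i) (q i)).degreeOf l ≤ N := by
  classical
  rw [degreeOf_le_iff]
  intro e he
  obtain ⟨i, hi, he'⟩ := Finset.mem_biUnion.mp (support_sum he)
  have : e = s i := Finset.mem_singleton.mp (support_monomial_subset he')
  rw [this]
  exact h i hi

/-- `Q ≠ 0` for an injective presentation with one nonzero coefficient (V3: the engine's Siegel step
provides the nonzero coefficient; injectivity = distinct exponent vectors). [folklore] -/
theorem sum_monomial_ne_zero {ι : Type*} (I : Finset ι) (s : ι → (Fin (m + 1) →₀ ℕ)) (q : ι → ℂ)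
    (hinj : Set.InjOn s I) {i₀ : ι} (hi₀ : i₀ ∈ I) (hq : q i₀ ≠ 0) :
    ∑ i ∈ I, monomial (s i) (q i) ≠ 0 := by
  classical
  intro h
  have hc := congrArg (coeff (s i₀)) h
  rw [coeff_sum, coeff_zero, Finset.sum_eq_single i₀] at hc
  · rw [coeff_monomial, if_pos rfl] at hc
    exact hq hc
  · intro i hi hne
    rw [coeff_monomial, if_neg]
    exact fun hs => hne (hinj hi hi₀ hs)
  · exact fun h' => absurd hi₀ h'

/-- The canonical shifted exponents `sᵢ = (aᵢ; κᵢ + D)` (as finitely supported functions) satisfy the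
bookkeeping hypotheses of the shift lemma when `−Dⱼ ≤ κᵢⱼ`. [folklore] -/
theorem shiftedExponents_spec {ι : Type*} (a : ι → ℕ) (κ : ι → Fin m → ℤ) (D : Fin m → ℕ) (i : ι)
    (hκ : ∀ j, -(D j : ℤ) ≤ κ i j) :
    (Finsupp.equivFunOnFinite.symm (Fin.cons (a i) fun j => (κ i j + D j).toNat) :
        Fin (m + 1) →₀ ℕ) 0 = a i ∧
      ∀ j : Fin m, (((Finsupp.equivFunOnFinite.symm (Fin.cons (a i) fun j => (κ i j + D j).toNat) :
        Fin (m + 1) →₀ ℕ) j.succ : ℕ) : ℤ) = κ i j + D j := by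
  refine ⟨by simp, fun j => ?_⟩
  simp only [Finsupp.coe_equivFunOnFinite_symm, Fin.cons_succ]
  have := hκ j
  omega

/-- **HEADLINE (Laurent form) — engine data ⇒ the obstruction subgroup.**  From the Laurent
presentation of the engine's auxiliary function (`aᵢ ≤ D₀`, `|κᵢⱼ| ≤ Dⱼ`, distinct exponent vectors,
one nonzero coefficient), its identities (5.4) for `|x| ≤ (m+1)X`, `t + ∑ νₖ ≤ (m+1)S₀`, `ν_{j₀} = 0`,
and the zero estimate `hZ : Nesterenko2003_prop51`: the obstruction subgroup `H = 𝔙 × T_Φ` with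
Nesterenko's inequality at multidegree `(D₀, D₁, …, Dₘ)` — the input of the engine's END (p4's
`NesterenkoZeroEnd`, with the orbit count `ncard_image_mk_zpowSet`). [cite: Nesterenko2003, §5.2 p. 92] -/
theorem exists_obstruction_of_laurentIdentities (hZ : Nesterenko2003_prop51)
    (b : Fin m → ℂ) (j₀ : Fin m) (hb : b j₀ ≠ 0)
    (W : Submodule ℂ (ℂ × (Fin m → ℂ))) (hWb : ∀ u ∈ W, ∑ j, b j * u.2 j = 0)
    (c : ℂ) (ξ : Fin m → ℂˣ) {ι : Type*} (I : Finset ι) (a : ι → ℕ) (κ : ι → Fin m → ℤ) (q : ι → ℂ)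
    (D₀ S₀ X : ℕ) (D : Fin m → ℕ)
    (ha : ∀ i ∈ I, a i ≤ D₀) (hκ : ∀ i ∈ I, ∀ j, |κ i j| ≤ (D j : ℤ))
    (hinj : Set.InjOn (fun i => (a i, κ i)) I) {i₀ : ι} (hi₀ : i₀ ∈ I) (hq : q i₀ ≠ 0)
    (hL : ∀ x : ℤ, |x| ≤ (((m + 1) * X : ℕ) : ℤ) → ∀ (t : ℕ) (ν : Fin m → ℕ), ν j₀ = 0 →
      t + ∑ k, ν k ≤ (m + 1) * S₀ →
      ∑ i ∈ I, q i * (((a i).descFactorial t : ℕ) : ℂ) * ((x : ℂ) * c) ^ (a i - t) *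
        (∏ k, (b j₀ * (κ i k : ℂ) - b k * (κ i j₀ : ℂ)) ^ ν k) *
        ∏ j, (ξ j : ℂ) ^ (x * κ i j) = 0) :
    ∃ (H : ConnAlgSubgroup m) (r : ℕ) (M : Matrix (Fin r) (Fin m) ℤ),
      LinearIndependent ℤ (fun i => M i) ∧
      H.chars = AddSubgroup.closure (Set.range fun i => M i) ∧
      H.addDim + (m - r) ≤ m ∧
      Nat.choose (S₀ + (Module.finrank ℂ W - Module.finrank ℂ ↥(W ⊓ H.tangent)))
          (Module.finrank ℂ W - Module.finrank ℂ ↥(W ⊓ H.tangent)) *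
        Set.ncard ((QuotientGroup.mk : GaGm m → GaGm m ⧸ H.toSubgroup) ''
          {g : GaGm m | ∃ x : ℤ, |x| ≤ (X : ℤ) ∧ g = ((Multiplicative.ofAdd c, ξ) : GaGm m) ^ x}) *
        nesterenkoH m r H.addDim M D₀ D ≤ (m + 1).factorial * 2 ^ m * D₀ * ∏ j, D j := by
  classical
  -- the shifted presentation
  set s : ι → (Fin (m + 1) →₀ ℕ) := fun i =>
    Finsupp.equivFunOnFinite.symm (Fin.cons (a i) fun j => (κ i j + D j).toNat) with hsdef
  have hκ' : ∀ i ∈ I, ∀ j, -(D j : ℤ) ≤ κ i j := fun i hi j => (abs_le.mp (hκ i hi j)).1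
  have hs0 : ∀ i ∈ I, s i 0 = a i := fun i hi => (shiftedExponents_spec a κ D i (hκ' i hi)).1
  have hsj : ∀ i ∈ I, ∀ j : Fin m, (((s i) j.succ : ℕ) : ℤ) = κ i j + D j := fun i hi =>
    (shiftedExponents_spec a κ D i (hκ' i hi)).2
  set Q : MvPolynomial (Fin (m + 1)) ℂ := ∑ i ∈ I, monomial (s i) (q i) with hQdef
  -- injectivity of the shifted presentation
  have hinj' : Set.InjOn s I := by
    intro i hi i' hi' h
    apply hinj hi hi'
    have h0 : a i = a i' := by rw [← hs0 i hi, ← hs0 i' hi', h]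
    have hj : κ i = κ i' := by
      funext j
      have := hsj i hi j
      rw [h, hsj i' hi' j] at this
      omega
    simp only [h0, hj]
  refine exists_obstruction_of_presentedIdentities b j₀ hZ hb W hWb c ξ I s q Q hQdef
    (sum_monomial_ne_zero I s q hinj' hi₀ hq) D₀ S₀ X D
    (degreeOf_sum_monomial_le I s q 0 D₀ fun i hi => by rw [hs0 i hi]; exact ha i hi)
    (fun j => degreeOf_sum_monomial_le I s q j.succ (2 * D j) fun i hi => ?_)
    (presentedIdentities_of_laurentIdentities b j₀ c ξ I a κ q D s hs0 hsj _ _ hL)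
  have h1 := hsj i hi j
  have h2 := (abs_le.mp (hκ i hi j)).2
  omega

end Shift

end Summit.ABC.StewartYu.GenThreeVanishing

end
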